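import Summits.QuantumFields.YangMills.Theorems.BalabanUVNodesK2NamedJetsRunRemAt

/-! # CRIT-2 g3 — ROUND 6 on idea-5 (`two-bound-activity-interpolation` ED.6.1): the RUN object has a ONE-POLYMER JUNK inhabitant

`ActivityRepr`, `LinOnRuns`, `ContAlongRuns`, `LocDomainZ4` below are VERBATIM copies of
`Cruxes/EndpointGivenBR13SepCoPH/Idea5g13RunOnlyRoadSketch6.lean` (cf5a38d06cd8) :341 ∕ :348–358 ∕ :362–366 ∕ :1590–1591
(a Crux module is not importable on the farm — `import …Idea5g13RunOnlyRoadSketch6` answered rc 75 three times — hence the copy).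

FINDING (price P-JUNK, not a strike).  For ANY history β-function `β`, ANY reference sequence `b`, ANY window `γ₀` with `β − b`
bounded by `B` along the in-window (0.20)-runs, `ActivityRepr β b γ₀` (D-REPR's fibre, run edition) is inhabited by the junk
representation putting the WHOLE remainder on the single polymer `∅` with frozen majorant `B` (`junkRepr`).  About that inhabitant
the card's obligations ARE the stub contents themselves: `LinOnRuns` ⟺ the `g_k`-linear run remainder of `β` w.r.t. `b`
(`linOnRuns_junk_iff`); `ContAlongRuns` ⟺ continuity of `β − b` along the clamped runs on the survivor sets, i.e. (C) up to a
constant (`contAlongRuns_junk_iff`).  So «inhabit `RunRecordRepr13`» is dischargeable by junk as soon as a run-wise bound on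
`β − N` is known, and a line «D-REPR + `stub_linOnRuns13R` + `stub_contAlongRuns13R` + `stub_driftAtN13R`, ★¹¹ by `exact`» keyed to an
UNPINNED `𝓡` is v8's stubs in costume; the card's private content lives only in a PINNED inhabitant (print's polymer activities as a
closed term) — definer pen first, as priced since ROUND 2.  Nothing of Bałaban is asserted; [B12]∕[I] Thm 2 ∕ (0.31) p.259 unproved in
print; R4 closes only the conditional finite-𝕋⁴ rung `BalabanLadder.UV`; the YM mass gap (Clay) is NOT proved by any of this. -/

open Literature.MathematicalPhysics.QuantumFieldTheory.Balaban1983to89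
open Literature.MathematicalPhysics.QuantumFieldTheory.Balaban1983to89.FlowStep
open Summit.QuantumFields.YangMills.Theorems.BalabanUVNodesK2NamedJetsRunRemAt

namespace Summit.QuantumFields.YangMills.Cruxes.EndpointGivenBR13SepCoPH.Crit2RunReprJunk

/-- VERBATIM Sketch6 :341. -/
abbrev LocDomainZ4 : Type := Finset (Fin 4 → ℤ)

/-- VERBATIM Sketch6 :348–358 (D-REPR's fibre, run edition). -/
structure ActivityRepr (β : HBeta) (b : ℕ → ℝ) (γ₀ : ℝ) where
  /-- the X-localized term of the remainder at scale k as a function of the history `(g_0,…,g_k)` -/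
  I : LocDomainZ4 → (k : ℕ) → (Fin (k + 1) → ℝ) → ℝ
  /-- the frozen majorant of the X-term -/
  M : LocDomainZ4 → ℝ
  M_nonneg : ∀ X, 0 ≤ M X
  M_summable : Summable M
  hasSum_run : ∀ (n : ℕ) (gs : ℕ → ℝ), RGEqH n β gs → Step.InInterval γ₀ n gs → ∀ k, k ≤ n →
    HasSum (fun X => I X k (prefixOf gs k)) (β k (prefixOf gs k) - b k)
  frozen_run : ∀ (n : ℕ) (gs : ℕ → ℝ), RGEqH n β gs → Step.InInterval γ₀ n gs → ∀ k, k ≤ n →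
    ∀ X, |I X k (prefixOf gs k)| ≤ M X

variable {β : HBeta} {b : ℕ → ℝ} {γ₀ : ℝ}

/-- VERBATIM Sketch6 :362–366 (S-LIN about a given representation). -/
def LinOnRuns (R : ActivityRepr β b γ₀) : Prop :=
  ∃ A : LocDomainZ4 → ℝ, (∀ X, 0 ≤ A X) ∧
    ∀ (n : ℕ) (gs : ℕ → ℝ), RGEqH n β gs → Step.InInterval γ₀ n gs → ∀ k, k ≤ n →
      ∀ X, |R.I X k (prefixOf gs k)| ≤ A X * gs k

/-- VERBATIM Sketch6 :1590–1591 ((a0ᴿ) termwise continuity along the clamped runs). -/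
def ContAlongRuns (R : ActivityRepr β b γ₀) : Prop :=
  ∀ (X : LocDomainZ4) (k : ℕ), ContinuousOn (fun x : ℝ => R.I X k (clampPrefix β γ₀ k x)) (Survivors β γ₀ k)

/-- Boundedness of the remainder along the in-window runs — the only input the junk inhabitant needs (= `RunConstRemainder β b B γ₀` of the tree, restated). [folklore] -/
def RunBounded (β : HBeta) (b : ℕ → ℝ) (γ₀ B : ℝ) : Prop :=
  ∀ (n : ℕ) (gs : ℕ → ℝ), RGEqH n β gs → Step.InInterval γ₀ n gs → ∀ k, k ≤ n → |β k (prefixOf gs k) - b k| ≤ B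

/-- `RunBounded` IS the tree's `RunConstRemainder` (`Iff.rfl`). [folklore] -/
theorem runBounded_iff_runConstRemainder {B : ℝ} : RunBounded β b γ₀ B ↔ RunConstRemainder β b B γ₀ := Iff.rfl

/-- **The one-polymer junk representation**: `I ∅ k := β_k − b_k`, `I X := 0` otherwise; majorant `M ∅ := B`, `0` otherwise. [folklore] -/
noncomputable def junkRepr (β : HBeta) (b : ℕ → ℝ) (γ₀ : ℝ) {B : ℝ} (hB : 0 ≤ B) (hbd : RunBounded β b γ₀ B) :
    ActivityRepr β b γ₀ where
  I := fun X k p => if X = ∅ then β k p - b k else 0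
  M := fun X => if X = ∅ then B else 0
  M_nonneg := fun X => by
    by_cases hX : X = ∅ <;> simp [hX, hB]
  M_summable := summable_of_ne_finset_zero (s := {∅}) fun X hX => by
    simp only [Finset.mem_singleton] at hX
    simp [hX]
  hasSum_run := fun n gs _ _ k _ => hasSum_ite_eq ∅ (β k (prefixOf gs k) - b k)
  frozen_run := fun n gs hrg hI k hk X => by
    by_cases hX : X = ∅
    · simpa [hX] using hbd n gs hrg hI k hk
    · simp [hX]

/-- **S-LIN about the junk object IS the `g_k`-linear run remainder of `β` itself.** [folklore] -/
theorem linOnRuns_junk_iff {B : ℝ} (hB : 0 ≤ B) (hbd : RunBounded β b γ₀ B) :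
    LinOnRuns (junkRepr β b γ₀ hB hbd) ↔
      ∃ A : ℝ, 0 ≤ A ∧ ∀ (n : ℕ) (gs : ℕ → ℝ), RGEqH n β gs → Step.InInterval γ₀ n gs → ∀ k, k ≤ n →
        |β k (prefixOf gs k) - b k| ≤ A * gs k := by
  constructor
  · rintro ⟨A, hA, h⟩
    refine ⟨A ∅, hA ∅, fun n gs hrg hI k hk => ?_⟩
    simpa [junkRepr] using h n gs hrg hI k hk ∅
  · rintro ⟨A, hA, h⟩
    refine ⟨fun X => if X = ∅ then A else 0, fun X => by by_cases hX : X = ∅ <;> simp [hX, hA], ?_⟩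
    intro n gs hrg hI k hk X
    by_cases hX : X = ∅
    · simpa [junkRepr, hX] using h n gs hrg hI k hk
    · simp [junkRepr, hX]

/-- **(a0ᴿ) about the junk object IS continuity of `β − b` along the clamped runs on the survivors** — (C) up to the constant `b_k`. [folklore] -/
theorem contAlongRuns_junk_iff {B : ℝ} (hB : 0 ≤ B) (hbd : RunBounded β b γ₀ B) :
    ContAlongRuns (junkRepr β b γ₀ hB hbd) ↔
      ∀ k : ℕ, ContinuousOn (fun x : ℝ => β k (clampPrefix β γ₀ k x) - b k) (Survivors β γ₀ k) := by
  constructor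
  · intro h k
    simpa [junkRepr] using h ∅ k
  · intro h X k
    by_cases hX : X = ∅
    · simpa [junkRepr, hX] using h k
    · simpa [junkRepr, hX] using (continuousOn_const (c := (0 : ℝ)))

/-- … hence ⟺ (C) `SurvCont β γ₀` itself. [folklore] -/
theorem contAlongRuns_junk_iff_survCont {B : ℝ} (hB : 0 ≤ B) (hbd : RunBounded β b γ₀ B) :
    ContAlongRuns (junkRepr β b γ₀ hB hbd) ↔ SurvCont β γ₀ := by
  rw [contAlongRuns_junk_iff]
  constructor
  · intro h k
    have h' := (h k).add (continuousOn_const (c := b k))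
    refine h'.congr fun x _ => ?_
    simp only [Pi.add_apply, sub_add_cancel]
  · intro h k
    exact (h k).sub (continuousOn_const (c := b k))

end Summit.QuantumFields.YangMills.Cruxes.EndpointGivenBR13SepCoPH.Crit2RunReprJunk
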